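import Literature.NumberTheory.Rogawski1990.ArchInnerFormSemiregularProper      -- ★ p850279 (J-DESC) D4b-1: `gprimeBlock_const`, `gprimeTorus_eq_symm_blockChart`, `uniformlyProper_gprimeBlock_cpt_of_injective`; brings D4a, D1c, the atlas
import HarnessLib

/-!
# Harish-Chandra's compactness lemma for the `G′_∞`-atlas at the REAL WALL `x_{w₀} = 0` of a SPLIT-chart place (the Cayley point) — modulo the centraliser of the wall point
# (Rogawski 1990 §4.12 Lemma 4.12.1, §8.2 pp. 114, 122–123; Knapp 1986 V §3; Shelstad 1979 §4; Harish-Chandra–van Dijk 1970 Part I §3 Lemma 22)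

Topic `NumberTheory/Rogawski1990`; namespace `Literature.NumberTheory.Rogawski1990`.  THEOREMS ONLY (no `def`, no instance, no notation, no axiom, no named fact, no `sorry`).
Cell `pub/hodgecm-mathlib`, crux H413 (`stmt-HodgeConjecture-24833`), F0∕P3c line LH3 (closer stub `stub_N9`, organ J), brick **(J-DESC) FILE D4b-1β** (seat F0P3a-p08 (g22);
the (β) = SPLIT side of my 2026-09-02T07:5xZ scope line: the chart `S♯ ∋ w₀` through the Cayley point `hcCayPt`, where the (G′-CAY) limit of LH3-p02 (g2)'s docks is read).

THE CHART AT `w₀ ∈ S♯ ∩ splitChartPlaces`.  `gprimeBlock α w₀ S♯ c = gprimeSplitGL τ a (c w₀)` (★ `coe_gprimeBlock_of_mem`; `τ = lineOf s`, `a = formRe`), whose matrix is the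
re-indexed boost `(boostStd (a ∘ τ) cw).submatrix τ⁻¹ τ⁻¹ = P · diag(ℓ ↦ boostEig cw (τ⁻¹ ℓ)) · P⁻¹` with the `cw`-INDEPENDENT frame `P = (cayB (a ∘ τ)).submatrix τ⁻¹ τ⁻¹`
(★ `boostStd_eq_conj_diagonal`) — a FRAMED DIAGONAL chart in the sense of ★ D1b ED. 2 `uniformlyProper_framedDiagonal_of_ne`, and the frame FIXES `E_{τ1,τ1}` (`cayB` is block
diagonal for `{1} ∪ {0,2}`: `cayB_mul_single_one_one`, `single_one_one_mul_cayB`).  Eigenvalues on the lines: `τ0 ↦ e^{x+iθ}`, `τ1 ↦ e^{iφ}`, `τ2 ↦ e^{−x+iθ}`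
(`x, φ, θ = cw 0, cw 1, cw 2`): at the real wall `x = 0` the lines `τ0, τ2` collide and `τ1` stays simple iff `e^{iφ} ≠ e^{iθ}` — the Cayley point of a noncompact wall.
* §1 frame bookkeeping: `cayB_mul_single_one_one`, `single_one_one_mul_cayB`, `submatrix_single_equiv`, `coe_gprimeBlock_split_eq_framed` (the block IS `P diag P⁻¹`),
  `framed_single_eq` (`P E_{τ1,τ1} P⁻¹ = E_{τ1,τ1}`);
* §2 **`uniformlyProper_gprimeBlock_split_of_ne`** — (HYP) for `cw ↦ gprimeBlock α w₀ S♯ (fun _ ↦ cw)` modulo any `M ≥ Stab(e_{τ1})` on `{cw ∣ ∀ j ≠ 1, boostEig cw 1 ≠ boostEig cw j}`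
  (ACROSS `x = 0`); `stabilizer_single_le_centralizer_gprimeBlock_split_of_wall` (`Stab(e_{τ1}) ≤ Z(block at p)` when `p w₀ 0 = 0`, via ★ `gprimeSplitMatrix_zero`);
* §3 **`uniformlyProper_gprimeTorus_of_semireg_split`**, **`exists_isCompact_mul_gprimeTorus_of_semireg_split`** — the atlas statements modulo `Z(gprimeTorus S♯ p)` on
  `Set.pi univ S` (★ D4a assembly; the OTHER split places by the hypothesis `hsplit`, the compact-chart places by ★ `uniformlyProper_gprimeBlock_cpt_of_injective`).
HONEST LABEL: HC_CM is proved only modulo the 7 printed citations (2 remaining named inputs: hLiu418 = `stmt-HodgeConjecture-24832`, h413 = `stmt-HodgeConjecture-24833`) until rung 0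
closes; count-neutral topology under organ J of `stub_N9`.

## References
* [Rogawski1990] J. D. Rogawski, *Automorphic Representations of Unitary Groups in Three Variables*, Ann. of Math. Stud. 123 (1990), §4.12 Lemma 4.12.1 p. 66, §8.2 p. 114, pp.
  122–123 (the walls of `U(2,1)`; `γ₂ → γ₀`), §3.6 p. 31.
* [Knapp1986] A. W. Knapp, *Representation Theory of Semisimple Groups* (1986), Ch. V §3 (the noncompact Cartan of `SU(2,1)`, the boost and its eigenvectors).
* [Shelstad1979] D. Shelstad, *Characters and inner forms of a quasi-split group over ℝ*, Compositio Math. 39 (1979), §4 p. 25 (the Cayley transform at a noncompact wall).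
* [HarishChandra1970] Harish-Chandra (notes by G. van Dijk), *Harmonic Analysis on Reductive p-adic Groups*, LNM 162 (1970), Part I §3 Lemma 22.
-/

set_option autoImplicit false

noncomputable section

open MeasureTheory Set Topology NumberField NumberField.InfinitePlace Matrix Complex
open Literature.MeasureTheory.Group Literature.NumberTheory.Automorphic Literature.NumberTheory.Automorphic.UnitaryGroup
open scoped MatrixGroups Matrix Pointwise

namespace Literature.NumberTheory.Rogawski1990

/-! ## §1 The boost frame fixes `E₁₁`; the split block is a framed diagonal chart -/

section Frame

/-- `cayB b · E₁₁ = E₁₁` (the second column of `cayB b` is `e₁`). [cite: Knapp1986, Ch. V §3] -/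
theorem cayB_mul_single_one_one (b : Fin 3 → ℝ) : cayB b * Matrix.single 1 1 (1 : ℂ) = Matrix.single 1 1 (1 : ℂ) := by
  ext i j
  fin_cases i <;> fin_cases j <;> simp [cayB, Matrix.mul_apply, Matrix.single_apply]

/-- `E₁₁ · cayB b = E₁₁` (the second row of `cayB b` is `e₁ᵀ`). [cite: Knapp1986, Ch. V §3] -/
theorem single_one_one_mul_cayB (b : Fin 3 → ℝ) : Matrix.single 1 1 (1 : ℂ) * cayB b = Matrix.single 1 1 (1 : ℂ) := by
  ext i j
  fin_cases i <;> fin_cases j <;> simp [cayB, Matrix.mul_apply, Matrix.single_apply]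

/-- Re-indexing a matrix unit by an equivalence: `(E_{kk}).submatrix σ σ = E_{σ⁻¹k, σ⁻¹k}`. [folklore] -/
private theorem submatrix_single_equiv {n : Type*} [DecidableEq n] (σ : n ≃ n) (k : n) :
    (Matrix.single k k (1 : ℂ)).submatrix σ σ = Matrix.single (σ.symm k) (σ.symm k) (1 : ℂ) := by
  ext i j
  simp only [Matrix.submatrix_apply, Matrix.single_apply]
  by_cases h : k = σ i ∧ k = σ j
  · rw [if_pos h, if_pos ⟨σ.symm_apply_eq.2 h.1, σ.symm_apply_eq.2 h.2⟩]
  · rw [if_neg h, if_neg (fun h' => h ⟨σ.symm_apply_eq.1 h'.1, σ.symm_apply_eq.1 h'.2⟩)]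

variable (τ : Fin 3 ≃ Fin 3) (a : Fin 3 → ℝ)

/-- `det ((cayB (a ∘ τ)).submatrix τ⁻¹ τ⁻¹) ≠ 0` on a hyperbolic plane. [cite: Knapp1986, Ch. V §3] -/
theorem det_cayB_submatrix_ne_zero (h : a (τ 0) * a (τ 2) < 0) : ((cayB (a ∘ τ)).submatrix τ.symm τ.symm).det ≠ 0 := by
  rw [Matrix.det_submatrix_equiv_self]
  exact det_cayB_ne_zero (b := a ∘ τ) h

/-- **The split block is a FRAMED DIAGONAL chart**: `gprimeSplitMatrix τ a cw = P · diag(ℓ ↦ boostEig cw (τ⁻¹ ℓ)) · P⁻¹`, `P = (cayB (a ∘ τ)).submatrix τ⁻¹ τ⁻¹`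
(`cw`-independent). [cite: Knapp1986, Ch. V §3] [cite: Rogawski1990, §3.6 p. 31] -/
theorem gprimeSplitMatrix_eq_framed (h : a (τ 0) * a (τ 2) < 0) (cw : Fin 3 → ℝ) :
    gprimeSplitMatrix τ a cw =
      (cayB (a ∘ τ)).submatrix τ.symm τ.symm * Matrix.diagonal (fun ℓ => boostEig cw (τ.symm ℓ)) * ((cayB (a ∘ τ)).submatrix τ.symm τ.symm)⁻¹ := by
  rw [gprimeSplitMatrix, boostStd_eq_conj_diagonal (b := a ∘ τ) h cw, ← Matrix.submatrix_mul_equiv _ _ τ.symm τ.symm τ.symm,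
    ← Matrix.submatrix_mul_equiv _ _ τ.symm τ.symm τ.symm, Matrix.submatrix_diagonal_equiv, Matrix.inv_submatrix_equiv]
  rfl

/-- **The frame fixes `E_{τ1,τ1}`**: `P · E_{τ1,τ1} · P⁻¹ = E_{τ1,τ1}` for `P = (cayB (a ∘ τ)).submatrix τ⁻¹ τ⁻¹`. [cite: Knapp1986, Ch. V §3] -/
theorem cayB_submatrix_conj_single (h : a (τ 0) * a (τ 2) < 0) :
    (cayB (a ∘ τ)).submatrix τ.symm τ.symm * Matrix.single (τ 1) (τ 1) (1 : ℂ) * ((cayB (a ∘ τ)).submatrix τ.symm τ.symm)⁻¹ = Matrix.single (τ 1) (τ 1) (1 : ℂ) := by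
  have hu : IsUnit ((cayB (a ∘ τ)).submatrix τ.symm τ.symm).det := (det_cayB_submatrix_ne_zero τ a h).isUnit
  have h1 : (τ 1) = τ.symm.symm 1 := by simp
  have hs : Matrix.single (τ 1) (τ 1) (1 : ℂ) = (Matrix.single 1 1 (1 : ℂ)).submatrix τ.symm τ.symm := by
    rw [submatrix_single_equiv]; simp
  have hfix : (cayB (a ∘ τ)).submatrix τ.symm τ.symm * Matrix.single (τ 1) (τ 1) (1 : ℂ) =
      Matrix.single (τ 1) (τ 1) (1 : ℂ) * (cayB (a ∘ τ)).submatrix τ.symm τ.symm := by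
    rw [hs, Matrix.submatrix_mul_equiv, Matrix.submatrix_mul_equiv, cayB_mul_single_one_one, single_one_one_mul_cayB]
  rw [hfix, Matrix.mul_assoc, Matrix.mul_nonsing_inv _ hu, Matrix.mul_one]

end Frame

/-! ## §2 The split block chart at one place: (HYP) across its real wall, modulo `M ≥ Stab(e_{τ1})` -/

section Place

variable (L : Type) [Field L] [NumberField L] [IsCMField L] (α : Fin 3 → L) (S' : Finset {w : InfinitePlace L // IsComplex w})

omit [NumberField L] [IsCMField L] in
/-- At a split-chart place of `S′` the block chart is the framed diagonal chart `P · diag(boostEig ∘ τ⁻¹) · P⁻¹` (as a `GL₃(ℂ)` identity). [cite: Knapp1986, Ch. V §3] -/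
theorem coe_gprimeBlock_split_eq_framed {w : {w : InfinitePlace L // IsComplex w}} (hw : w ∈ S') (hsp : w ∈ splitChartPlaces L α) (cw : Fin 3 → ℝ) :
    (((gprimeBlock L α w S' (fun _ => cw) : ↥(archLocal L 3 (Matrix.diagonal α) w)) : GL (Fin 3) ℂ) : Matrix (Fin 3) (Fin 3) ℂ) =
      ((Matrix.GeneralLinearGroup.mkOfDetNeZero _ (det_cayB_submatrix_ne_zero (lineOf (formSign L α w)) (formRe L α w) hsp.2) : GL (Fin 3) ℂ) : Matrix (Fin 3) (Fin 3) ℂ) *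
        Matrix.diagonal (fun ℓ => boostEig cw ((lineOf (formSign L α w)).symm ℓ)) *
        (((Matrix.GeneralLinearGroup.mkOfDetNeZero _ (det_cayB_submatrix_ne_zero (lineOf (formSign L α w)) (formRe L α w) hsp.2))⁻¹ : GL (Fin 3) ℂ) :
          Matrix (Fin 3) (Fin 3) ℂ) := by
  rw [coe_gprimeBlock_of_mem L α _ hw hsp, coe_gprimeSplitGL, Matrix.coe_units_inv, Matrix.GeneralLinearGroup.val_mkOfDetNeZero]
  exact gprimeSplitMatrix_eq_framed _ _ hsp.2 cw

omit [NumberField L] [IsCMField L] in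
/-- **(HYP) FOR THE SPLIT BLOCK CHART ACROSS ITS REAL WALL**: `cw ↦ gprimeBlock α w S′ (fun _ ↦ cw)` at `w ∈ S′ ∩ splitChartPlaces` is uniformly proper modulo any `M ≥ Stab(e_{τ1})`
(`τ = lineOf (formSign L α w)`) on the set where the compact-line eigenvalue `boostEig cw 1 = e^{iφ}` is SIMPLE (`≠ e^{±x+iθ}`) — the real wall `x = 0` INCLUDED.
(★ D1b ED. 2 `uniformlyProper_framedDiagonal_of_ne` with the boost frame, §1.) [cite: Rogawski1990, §4.12 Lemma 4.12.1 p. 66; §8.2 pp. 122–123] [cite: Knapp1986, Ch. V §3]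
[cite: HarishChandra1970, Part I §3 Lemma 22] -/
theorem uniformlyProper_gprimeBlock_split_of_ne (hα : ∀ i, α i ≠ 0) {w : {w : InfinitePlace L // IsComplex w}} (hw : w ∈ S') (hsp : w ∈ splitChartPlaces L α)
    (M : Subgroup ↥(archLocal L 3 (Matrix.diagonal α) w))
    (hM : MulAction.stabilizer ↥(archLocal L 3 (Matrix.diagonal α) w) (Pi.single (lineOf (formSign L α w) 1) (1 : ℂ) : Fin 3 → ℂ) ≤ M) :
    ∀ K ⊆ {cw : Fin 3 → ℝ | ∀ j, j ≠ 1 → boostEig cw 1 ≠ boostEig cw j}, IsCompact K → ∀ C : Set ↥(archLocal L 3 (Matrix.diagonal α) w), IsCompact C →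
      ∃ 𝒦 : Set (↥(archLocal L 3 (Matrix.diagonal α) w) ⧸ M), IsCompact 𝒦 ∧
        ∀ cw ∈ K, ∀ y : ↥(archLocal L 3 (Matrix.diagonal α) w), y * gprimeBlock L α w S' (fun _ => cw) * y⁻¹ ∈ C →
          (QuotientGroup.mk y : ↥(archLocal L 3 (Matrix.diagonal α) w) ⧸ M) ∈ 𝒦 := by
  obtain ⟨hJ, hJJ', hJk, hkk⟩ := diagonal_map_embedding_hermitian_and_inv L 3 α w hα hsp.1
  set τ := lineOf (formSign L α w) with hτ
  have hd : ∀ ℓ : Fin 3, Continuous fun cw : Fin 3 → ℝ => boostEig cw (τ.symm ℓ) := by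
    intro ℓ
    have h0 : Continuous fun cw : Fin 3 → ℝ => boostEig cw 0 := by
      simp only [boostEig, Matrix.cons_val_zero]
      exact Complex.continuous_exp.comp ((Complex.continuous_ofReal.comp (continuous_apply 0)).add ((Complex.continuous_ofReal.comp (continuous_apply 2)).mul continuous_const))
    have h1 : Continuous fun cw : Fin 3 → ℝ => boostEig cw 1 := by
      simp only [boostEig, Matrix.cons_val_one, Matrix.cons_val_zero]
      exact Complex.continuous_exp.comp ((Complex.continuous_ofReal.comp (continuous_apply 1)).mul continuous_const)
    have h2 : Continuous fun cw : Fin 3 → ℝ => boostEig cw 2 := by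
      simp only [boostEig, Matrix.cons_val_two, Matrix.tail_cons, Matrix.head_cons]
      exact Complex.continuous_exp.comp ((Complex.continuous_ofReal.comp (continuous_apply 0)).neg.add ((Complex.continuous_ofReal.comp (continuous_apply 2)).mul continuous_const))
    generalize τ.symm ℓ = m
    fin_cases m
    · exact h0
    · exact h1
    · exact h2
  have hne : ∀ cw ∈ {cw : Fin 3 → ℝ | ∀ j, j ≠ 1 → boostEig cw 1 ≠ boostEig cw j}, ∀ ℓ, ℓ ≠ τ 1 →
      boostEig cw (τ.symm (τ 1)) ≠ boostEig cw (τ.symm ℓ) := by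
    intro cw hcw ℓ hℓ
    rw [Equiv.symm_apply_apply]
    exact hcw _ fun h => hℓ (by rw [← h, Equiv.apply_symm_apply])
  exact uniformlyProper_framedDiagonal_of_ne hJ hJJ' (τ 1) (hJk (τ 1)) (hkk (τ 1)) M hM
    (fun cw => gprimeBlock L α w S' (fun _ => cw)) _ (by
      rw [Matrix.coe_units_inv, Matrix.GeneralLinearGroup.val_mkOfDetNeZero]; exact cayB_submatrix_conj_single τ (formRe L α w) hsp.2)
    (fun cw ℓ => boostEig cw (τ.symm ℓ)) hd (coe_gprimeBlock_split_eq_framed L α S' hw hsp) hne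

omit [NumberField L] [IsCMField L] in
/-- **`Stab(e_{τ1}) ≤ Z(gprimeBlock p w)` AT THE REAL WALL `p w 0 = 0`** (there the block is the diagonal `diag` with the angle `θ` on the lines `τ0, τ2` and `φ` on `τ1`,
★ `gprimeSplitMatrix_zero`). [cite: Shelstad1979, §4 p. 25] [cite: Rogawski1990, §8.2 pp. 122–123] -/
theorem stabilizer_single_le_centralizer_gprimeBlock_split_of_wall (hα : ∀ i, α i ≠ 0) {w : {w : InfinitePlace L // IsComplex w}} (hw : w ∈ S')
    (hsp : w ∈ splitChartPlaces L α) (p : {w : InfinitePlace L // IsComplex w} → Fin 3 → ℝ) (hx : p w 0 = 0) :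
    MulAction.stabilizer ↥(archLocal L 3 (Matrix.diagonal α) w) (Pi.single (lineOf (formSign L α w) 1) (1 : ℂ) : Fin 3 → ℂ) ≤
      Subgroup.centralizer ({gprimeBlock L α w S' p} : Set ↥(archLocal L 3 (Matrix.diagonal α) w)) := by
  obtain ⟨-, -, hJk, hkk⟩ := diagonal_map_embedding_hermitian_and_inv L 3 α w hα hsp.1
  set τ := lineOf (formSign L α w) with hτ
  have hpw : p w = ![0, p w 1, p w 2] := by
    funext i; fin_cases i
    · exact hx
    · rfl
    · rfl
  have hcoe : (((gprimeBlock L α w S' p : ↥(archLocal L 3 (Matrix.diagonal α) w)) : GL (Fin 3) ℂ) : Matrix (Fin 3) (Fin 3) ℂ) =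
      Matrix.diagonal fun ℓ => Complex.exp (((![p w 2, p w 1, p w 2] : Fin 3 → ℝ) (τ.symm ℓ) : ℂ) * I) := by
    rw [coe_gprimeBlock_of_mem L α _ hw hsp, coe_gprimeSplitGL, hpw, gprimeSplitMatrix_zero, coe_gprimeCptGL]
    congr 1
  refine stabilizer_single_le_centralizer_of_diagonal (τ 1) (hJk (τ 1)) (hkk (τ 1)) _ hcoe
    (ζ := Complex.exp (((p w 2 : ℝ) : ℂ) * I)) fun ℓ hℓ => ?_
  have hm : τ.symm ℓ ≠ 1 := fun h => hℓ (by rw [← h, Equiv.apply_symm_apply])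
  generalize τ.symm ℓ = m at hm ⊢
  fin_cases m
  · rfl
  · exact absurd rfl hm
  · rfl

end Place

/-! ## §3 The atlas statements at a split-chart semi-regular point (the Cayley point) -/

section Atlas

variable (L : Type) [Field L] [NumberField L] [IsCMField L] (α : Fin 3 → L) (S' : Finset {w : InfinitePlace L // IsComplex w})

/-- **HARISH-CHANDRA'S COMPACTNESS LEMMA FOR THE ATLAS `gprimeTorus α S♯` NEAR THE REAL WALL OF A SPLIT PLACE `w₀ ∈ S♯` ((HYP) form).**  `p` with `p w₀ 0 = 0` (the Cayley
point side: lines `τ0, τ2` collide, `τ1` simple), per-place parameter sets `S w`: at `w₀`, `S w₀ ⊆ {boostEig · 1 simple}`; at the compact-chart places, `S w ⊆ {injective angles}`;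
at the OTHER split places the per-place (HYP) modulo `Z(gprimeBlock p w)` is the hypothesis `hsplit`.  Then `c ↦ gprimeTorus α S♯ c` is uniformly proper modulo
`Z(gprimeTorus α S♯ p)` on `Set.pi univ S`. [cite: Rogawski1990, §4.12 Lemma 4.12.1 p. 66; §8.2 p. 114] [cite: Shelstad1979, §4 p. 25] [cite: HarishChandra1970, Part I §3 Lemma 22] -/
theorem uniformlyProper_gprimeTorus_of_semireg_split (hα : ∀ i, α i ≠ 0)
    (p : {w : InfinitePlace L // IsComplex w} → Fin 3 → ℝ) (w₀ : {w : InfinitePlace L // IsComplex w}) (hw₀ : w₀ ∈ S') (hsp₀ : w₀ ∈ splitChartPlaces L α)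
    (hx : p w₀ 0 = 0)
    (S : {w : InfinitePlace L // IsComplex w} → Set (Fin 3 → ℝ))
    (hS₀ : S w₀ ⊆ {cw : Fin 3 → ℝ | ∀ j, j ≠ 1 → boostEig cw 1 ≠ boostEig cw j})
    (hScpt : ∀ w, ¬ (w ∈ S' ∧ w ∈ splitChartPlaces L α) → S w ⊆ {cw : Fin 3 → ℝ | Function.Injective fun i : Fin 3 => Circle.exp (cw i)})
    (hsplit : ∀ w, w ≠ w₀ → w ∈ S' ∧ w ∈ splitChartPlaces L α →
      ∀ K ⊆ S w, IsCompact K → ∀ C : Set ↥(archLocal L 3 (Matrix.diagonal α) w), IsCompact C →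
        ∃ 𝒦 : Set (↥(archLocal L 3 (Matrix.diagonal α) w) ⧸ Subgroup.centralizer ({gprimeBlock L α w S' p} : Set ↥(archLocal L 3 (Matrix.diagonal α) w))),
          IsCompact 𝒦 ∧ ∀ cw ∈ K, ∀ y : ↥(archLocal L 3 (Matrix.diagonal α) w), y * gprimeBlock L α w S' (fun _ => cw) * y⁻¹ ∈ C →
            (QuotientGroup.mk y : ↥(archLocal L 3 (Matrix.diagonal α) w) ⧸ Subgroup.centralizer ({gprimeBlock L α w S' p} : Set ↥(archLocal L 3 (Matrix.diagonal α) w))) ∈ 𝒦) :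
    ∀ K ⊆ Set.pi Set.univ S, IsCompact K →
      ∀ C' : Set ↥(arch (↥(maximalRealSubfield L)) L (IsCMField.complexConj L) 3 (Matrix.diagonal α)), IsCompact C' →
        ∃ 𝒦' : Set (↥(arch (↥(maximalRealSubfield L)) L (IsCMField.complexConj L) 3 (Matrix.diagonal α)) ⧸
            Subgroup.centralizer ({gprimeTorus L α S' p} : Set ↥(arch (↥(maximalRealSubfield L)) L (IsCMField.complexConj L) 3 (Matrix.diagonal α)))),
          IsCompact 𝒦' ∧ ∀ c ∈ K, ∀ y' : ↥(arch (↥(maximalRealSubfield L)) L (IsCMField.complexConj L) 3 (Matrix.diagonal α)),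
            y' * gprimeTorus L α S' c * y'⁻¹ ∈ C' →
              (QuotientGroup.mk y' : ↥(arch (↥(maximalRealSubfield L)) L (IsCMField.complexConj L) 3 (Matrix.diagonal α)) ⧸
                Subgroup.centralizer ({gprimeTorus L α S' p} : Set ↥(arch (↥(maximalRealSubfield L)) L (IsCMField.complexConj L) 3 (Matrix.diagonal α)))) ∈ 𝒦' := by
  have hMM' : ∀ g : ∀ w : {w : InfinitePlace L // IsComplex w}, ↥(archLocal L 3 (Matrix.diagonal α) w),
      (archPiEquivCM 3 L (Matrix.diagonal α)).symm g ∈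
          Subgroup.centralizer ({gprimeTorus L α S' p} : Set ↥(arch (↥(maximalRealSubfield L)) L (IsCMField.complexConj L) 3 (Matrix.diagonal α))) ↔
        g ∈ Subgroup.pi Set.univ fun w => Subgroup.centralizer ({gprimeBlock L α w S' p} : Set ↥(archLocal L 3 (Matrix.diagonal α) w)) :=
    fun g => by
      rw [gprimeTorus, show ((archPiEquivCM 3 L (Matrix.diagonal α)).symm g) = (archPiEquivCM 3 L (Matrix.diagonal α)).symm.toMulEquiv g from rfl,
        show ((archPiEquivCM 3 L (Matrix.diagonal α)).symm fun w => gprimeBlock L α w S' p) =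
          (archPiEquivCM 3 L (Matrix.diagonal α)).symm.toMulEquiv (fun w => gprimeBlock L α w S' p) from rfl,
        mulEquiv_apply_mem_centralizer_singleton_iff, Subgroup.mem_centralizer_singleton_iff, Subgroup.mem_pi]
      simp only [Set.mem_univ, true_imp_iff, Subgroup.mem_centralizer_singleton_iff]
      exact ⟨fun h w => congrFun h w, fun h => funext h⟩
  have hprop : ∀ w : {w : InfinitePlace L // IsComplex w}, ∀ K ⊆ S w, IsCompact K → ∀ C : Set ↥(archLocal L 3 (Matrix.diagonal α) w), IsCompact C →
      ∃ 𝒦 : Set (↥(archLocal L 3 (Matrix.diagonal α) w) ⧸ Subgroup.centralizer ({gprimeBlock L α w S' p} : Set ↥(archLocal L 3 (Matrix.diagonal α) w))),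
        IsCompact 𝒦 ∧ ∀ cw ∈ K, ∀ y : ↥(archLocal L 3 (Matrix.diagonal α) w), y * gprimeBlock L α w S' (fun _ => cw) * y⁻¹ ∈ C →
          (QuotientGroup.mk y : ↥(archLocal L 3 (Matrix.diagonal α) w) ⧸ Subgroup.centralizer ({gprimeBlock L α w S' p} : Set ↥(archLocal L 3 (Matrix.diagonal α) w))) ∈ 𝒦 := by
    intro w
    by_cases hws : w ∈ S' ∧ w ∈ splitChartPlaces L α
    · by_cases hw0 : w = w₀
      · subst hw0
        exact uniformlyProper_mono _ _ hS₀ (uniformlyProper_gprimeBlock_split_of_ne L α S' hα hws.1 hws.2 _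
          (stabilizer_single_le_centralizer_gprimeBlock_split_of_wall L α S' hα hws.1 hws.2 p hx))
      · exact hsplit w hw0 hws
    · exact uniformlyProper_mono _ _ (hScpt w hws) (uniformlyProper_gprimeBlock_cpt_of_injective L α S' hα hws _)
  exact uniformlyProper_arch_of_places L 3 (Matrix.diagonal α) (fun w => Subgroup.centralizer ({gprimeBlock L α w S' p} : Set ↥(archLocal L 3 (Matrix.diagonal α) w)))
    (Subgroup.centralizer ({gprimeTorus L α S' p} : Set _)) hMM' (fun w cw => gprimeBlock L α w S' (fun _ => cw)) S hprop

/-- **Group-level form** at the split-chart semi-regular point: ONE compact `C″ ⊆ G′_∞` with `y′ ∈ C″ · Z(gprimeTorus p)` whenever `y′·gprimeTorus c·y′⁻¹ ∈ C′`, `c ∈ K`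
(`K ⊆ Set.pi univ S` compact) — the uniform `hCM` binder of the descent ★ D2∕D3. [cite: Rogawski1990, §4.12 Lemma 4.12.1 p. 66; §8.2 p. 114] [cite: DeitmarEchterhoff2014, Remark 1.5.2] -/
theorem exists_isCompact_mul_gprimeTorus_of_semireg_split (hα : ∀ i, α i ≠ 0)
    (p : {w : InfinitePlace L // IsComplex w} → Fin 3 → ℝ) (w₀ : {w : InfinitePlace L // IsComplex w}) (hw₀ : w₀ ∈ S') (hsp₀ : w₀ ∈ splitChartPlaces L α)
    (hx : p w₀ 0 = 0)
    (S : {w : InfinitePlace L // IsComplex w} → Set (Fin 3 → ℝ))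
    (hS₀ : S w₀ ⊆ {cw : Fin 3 → ℝ | ∀ j, j ≠ 1 → boostEig cw 1 ≠ boostEig cw j})
    (hScpt : ∀ w, ¬ (w ∈ S' ∧ w ∈ splitChartPlaces L α) → S w ⊆ {cw : Fin 3 → ℝ | Function.Injective fun i : Fin 3 => Circle.exp (cw i)})
    (hsplit : ∀ w, w ≠ w₀ → w ∈ S' ∧ w ∈ splitChartPlaces L α →
      ∀ K ⊆ S w, IsCompact K → ∀ C : Set ↥(archLocal L 3 (Matrix.diagonal α) w), IsCompact C →
        ∃ 𝒦 : Set (↥(archLocal L 3 (Matrix.diagonal α) w) ⧸ Subgroup.centralizer ({gprimeBlock L α w S' p} : Set ↥(archLocal L 3 (Matrix.diagonal α) w))),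
          IsCompact 𝒦 ∧ ∀ cw ∈ K, ∀ y : ↥(archLocal L 3 (Matrix.diagonal α) w), y * gprimeBlock L α w S' (fun _ => cw) * y⁻¹ ∈ C →
            (QuotientGroup.mk y : ↥(archLocal L 3 (Matrix.diagonal α) w) ⧸ Subgroup.centralizer ({gprimeBlock L α w S' p} : Set ↥(archLocal L 3 (Matrix.diagonal α) w))) ∈ 𝒦)
    {K : Set ({w : InfinitePlace L // IsComplex w} → Fin 3 → ℝ)} (hKS : K ⊆ Set.pi Set.univ S) (hK : IsCompact K)
    {C' : Set ↥(arch (↥(maximalRealSubfield L)) L (IsCMField.complexConj L) 3 (Matrix.diagonal α))} (hC' : IsCompact C') :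
    ∃ C'' : Set ↥(arch (↥(maximalRealSubfield L)) L (IsCMField.complexConj L) 3 (Matrix.diagonal α)), IsCompact C'' ∧
      ∀ c ∈ K, ∀ y' : ↥(arch (↥(maximalRealSubfield L)) L (IsCMField.complexConj L) 3 (Matrix.diagonal α)),
        y' * gprimeTorus L α S' c * y'⁻¹ ∈ C' →
          y' ∈ C'' * (Subgroup.centralizer ({gprimeTorus L α S' p} : Set ↥(arch (↥(maximalRealSubfield L)) L (IsCMField.complexConj L) 3 (Matrix.diagonal α))) :
            Set ↥(arch (↥(maximalRealSubfield L)) L (IsCMField.complexConj L) 3 (Matrix.diagonal α))) := by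
  obtain ⟨𝒦', h𝒦', hmem⟩ := uniformlyProper_gprimeTorus_of_semireg_split L α S' hα p w₀ hw₀ hsp₀ hx S hS₀ hScpt hsplit K hKS hK C' hC'
  obtain ⟨C'', hC'', hsub⟩ := exists_isCompact_image_mk_superset
    (Subgroup.centralizer ({gprimeTorus L α S' p} : Set ↥(arch (↥(maximalRealSubfield L)) L (IsCMField.complexConj L) 3 (Matrix.diagonal α)))) h𝒦'
  refine ⟨C'', hC'', fun c hc y' hy' => ?_⟩
  obtain ⟨a, ha, hay⟩ := hsub (hmem c hc y' hy')
  rw [QuotientGroup.eq] at hay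
  exact ⟨a, ha, a⁻¹ * y', hay, by group⟩

end Atlas

end Literature.NumberTheory.Rogawski1990
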